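import Summits.BirchSwinnertonDyer.BirchSwinnertonDyer.Theses.CyclotomicUntwist
import Summits.BirchSwinnertonDyer.BirchSwinnertonDyer.Theorems.CyclotomicUntwistFiniteSlopeSeparatedPinnedLogNormOneSidedSigmaLine
import Summits.BirchSwinnertonDyer.BirchSwinnertonDyer.Theorems.CyclotomicUntwistLineCoefficients
import Summits.BirchSwinnertonDyer.BirchSwinnertonDyer.Theorems.CyclotomicUntwistPSUntwistedTraceDefs
import Summits.BirchSwinnertonDyer.BirchSwinnertonDyer.Theorems.CyclotomicUntwistDescendedFrobeniusEigenconstantCoeffs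
import Literature.NumberTheory.EllipticCurves.DescendedFrobeniusMatrix
import HarnessLib

/-!
# K-SEP glue of route `CyclotomicUntwist`, K1 family (WAN side): `C4 → C5≥ → C1 → C2 → PSRankOneLowerHalfAtThree`
# (glue item stmt-BirchSwinnertonDyer-27617 `PSLowerHalfOfDFrobWanChildren`)

Cell `pub/bsd-wall` (D-0145 line `route-BirchSwinnertonDyer-CyclotomicUntwist`, rev 9), seat `bsd-line-cycu-p4` (gen 7),
executing the CU pen's TURNKEY T9 (bsd-wall-pss3x g5, 11:47:32Z; certificate `HOME/bsd-wall-pss3x/cuS/SketchK3.lean`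
sha16 1e0e4286bbe4bf3f, `psRankOneLowerHalfAtThree_of_dfrobWanChildren`, here VERBATIM with the route's decls). The
ONE-SIDED K1 family of rev 9: C4 `PSGrossZagierDescendedEigenlineAtThree` (27546, deciding), C5≥
`PSpAdicBSDWanSideDescendedEigenlineAtThree` (27614 = `stub_pBSD3ge_dfrob` of `Lines/dfrob_wan.lean`: the normed 3-adic
BSD inequality in the WAN direction only), C1 `PSUntwistedLFunctionAtThree` (27548), C2
`PSDescendedFrobeniusPrintedInputsAtThree` (27549, PUB ∧ S2); glue := C4 → C5≥ → C1 → C2 → K1. The proof is the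
composition of the registered line `dfrob_wan` (cycu-p1 g5) with stubs ↦ hypotheses, over cycu-p1's one-sided normed
closer `psRankOneLowerHalfAtThree_of_separated_pin_intrinsic_sigmaLine_log_norm_ge` (p628075), the D5 numbers `(a, b)`
CHOSEN per `(W, α)` as the `(1, ζ₃)`-coordinates of the eigenline constant of THE descended Frobenius matrix (S2 =
`h2.2`; S3 `eigenconstant_coeffs` p625113; canonical by `IsDescendedFrobeniusMatrix.unique`). Twin of cycu-p5 g9's
K2 glue `CyclotomicUntwistKSepGlueK2` (27594 ✓). THEOREMS ONLY; BSD is not proved by this file; K1 stays OPEN until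
its four children close (C4, C5≥, C1 research; C2 print).
-/

set_option linter.dupNamespace false
noncomputable section

open scoped Classical MatrixGroups
open CongruenceSubgroup WeierstrassCurve WeierstrassCurve.Affine.Point Literature.NumberTheory.EllipticCurves
  Literature.NumberTheory.EllipticCurves.ModularForms Literature.NumberTheory.EllipticCurves.Rank1Residual
  Literature.NumberTheory.IwasawaTheory Summit.BirchSwinnertonDyer.Rank1Residual.Additive
  Summit.BirchSwinnertonDyer.BirchSwinnertonDyer.Theses.CyclotomicUntwist
  Summit.BirchSwinnertonDyer.BirchSwinnertonDyer.Theorems.CyclotomicUntwistFiniteSlopeSeparatedPinnedLogNormOneSidedSigmaLine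
  Summit.BirchSwinnertonDyer.BirchSwinnertonDyer.Theorems.PSLineCoefficients
  IsCyclotomicExtension

namespace Summit.BirchSwinnertonDyer.BirchSwinnertonDyer.Theorems.CyclotomicUntwistKSepWanGlue

/-- **K1 from the WAN-side family**: C4 ∧ C5≥ ∧ C1 ∧ C2 ⊢ `PSRankOneLowerHalfAtThree` — the composition of the
registered line `dfrob_wan` with its stubs as hypotheses (pen certificate SketchK3.lean, verbatim). -/
theorem psRankOneLowerHalfAtThree_of_dfrobWanChildren
    (h4 : PSGrossZagierDescendedEigenlineAtThree) (h5 : PSpAdicBSDWanSideDescendedEigenlineAtThree)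
    (h1 : PSUntwistedLFunctionAtThree) (h2 : PSDescendedFrobeniusPrintedInputsAtThree) :
    PSRankOneLowerHalfAtThree := by
  -- the coefficient package
  obtain ⟨ψ, σ, hψ2, hψ3, hψ1, hσ⟩ := exists_line_and_conjugation
  obtain ⟨ι, hι⟩ := exists_algHom_padicComplex_injective
  -- the eigenline dictionary as a predicate on pairs `(a, b)`
  let Good : (W : WeierstrassCurve ℚ) → ℂ_[3] → ℚ_[3] × ℚ_[3] → Prop := fun W α ab =>
    ab.2 ≠ 0 ∧ ∀ M : Matrix (Fin 2) (Fin 2) ℚ_[3], W.IsDescendedFrobeniusMatrix M →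
      (algebraMap ℚ_[3] ℂ_[3] ab.1 + algebraMap ℚ_[3] ℂ_[3] ab.2 * ι (ψ 2)) * algebraMap ℚ_[3] ℂ_[3] (M 1 0) =
        algebraMap ℚ_[3] ℂ_[3] (M 0 0) + (α - algebraMap ℚ_[3] ℂ_[3] M.trace)
  -- the D5 numbers by choice (junk `(0, 1)` off the locus where the dictionary applies)
  let ab : (W : WeierstrassCurve ℚ) → DirichletCharacter ℂ_[3] (3 ^ 2) → ℂ_[3] → ℚ_[3] × ℚ_[3] :=
    fun W _ α => if h : ∃ p : ℚ_[3] × ℚ_[3], Good W α p then h.choose else (0, 1)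
  have hb : ∀ W η α, (ab W η α).2 ≠ 0 := by
    intro W η α
    show (if h : ∃ p : ℚ_[3] × ℚ_[3], Good W α p then h.choose else ((0 : ℚ_[3]), (1 : ℚ_[3]))).2 ≠ 0
    split_ifs with h
    · exact h.choose_spec.1
    · exact one_ne_zero
  have hgood : ∀ W η α, (∃ p : ℚ_[3] × ℚ_[3], Good W α p) → Good W α (ab W η α) := by
    intro W η α h
    show Good W α (if h : ∃ p : ℚ_[3] × ℚ_[3], Good W α p then h.choose else ((0 : ℚ_[3]), (1 : ℚ_[3])))
    rw [dif_pos h]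
    exact h.choose_spec
  -- on a principal-series row the dictionary applies at the admissible root `α`
  have hrow : ∀ (W : WeierstrassCurve ℚ) [W.IsElliptic] [W.IsGloballyMinimal],
      Summit.BirchSwinnertonDyer.Rank1Residual.Additive.ClassO6 W 3 →
      Even (padicValInt 3 W.minimalDiscriminantInt) →
      W.minimalDiscriminantInt / 3 ^ padicValInt 3 W.minimalDiscriminantInt % 3 = 1 →
      ∀ (η : DirichletCharacter ℂ_[3] (3 ^ 2)) (α : ℂ_[3]),
        α ^ 2 - ((W.psUntwistedTrace : ℤ) : ℂ_[3]) * α + 3 = 0 →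
        ∃ M : Matrix (Fin 2) (Fin 2) ℚ_[3], W.IsDescendedFrobeniusMatrix M ∧ Good W α (ab W η α) := by
    intro W _ _ hO6 hev hsq η α hroot
    obtain ⟨M, hM, htr, hγ⟩ := h2.2 W hO6 hev hsq
    have htr' : M.trace = 0 ∨ M.trace = 3 ∨ M.trace = -3 := by
      rcases Summit.BirchSwinnertonDyer.BirchSwinnertonDyer.Theorems.PSUntwistedTrace.psUntwistedTrace_eq_or W
        with h | h | h
      · exact Or.inl (by rw [htr, h]; push_cast; rfl)
      · exact Or.inr (Or.inl (by rw [htr, h]; push_cast; rfl))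
      · exact Or.inr (Or.inr (by rw [htr, h]; push_cast; rfl))
    have hroot' : α ^ 2 - algebraMap ℚ_[3] ℂ_[3] M.trace * α + 3 = 0 := by
      rw [htr, map_intCast]; exact hroot
    obtain ⟨a, b, hb0, hdict⟩ :=
      Summit.BirchSwinnertonDyer.BirchSwinnertonDyer.Theorems.PSDescendedFrobeniusEigenconstantCoeffs.eigenconstant_coeffs
        ψ ι hψ2 hι M α hM.det_eq htr' hγ hroot'
    refine ⟨M, hM, hgood W η α ⟨(a, b), hb0, fun M' hM' => ?_⟩⟩
    rw [hM'.unique hM]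
    exact hdict
  -- the closer of record
  have H := psRankOneLowerHalfAtThree_of_separated_pin_intrinsic_sigmaLine_log_norm_ge (R := CyclotomicField 3 ℚ_[3])
    ι hι ψ σ hσ ⟨hψ3, hψ1⟩ (fun _ _ _ => (0 : ℚ_[3])) (fun W η α => (ab W η α).1) (fun W η α => (ab W η α).2)
    (fun _ _ _ => by rw [norm_zero]; exact zero_le_one) hb
    (fun W η α Dh => ∀ χ : DirichletCharacter (CyclotomicField 3 ℚ_[3]) 9, (χ = ψ ∨ χ = ψ⁻¹) →
      ∀ {x y : ℚ} (hxy : W.toAffine.Nonsingular x y),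
        1 < ‖(x : ℚ_[3])‖ → ‖(-(x : ℚ_[3]) / (y : ℚ_[3]))‖ ≤ ((3 : ℝ)⁻¹) ^ 3 →
          (∀ ℓ : ℕ, ℓ.Prime → W.HasNonsingularReductionAt ℓ x y) →
            Dh.pairing χ (.some x y hxy) (.some x y hxy) =
              algebraMap ℚ_[3] (CyclotomicField 3 ℚ_[3]) (CensusX42.sigmaHeight W 3
                  ((W.baseChange ℚ_[3]).formalSigma 0) (.some x y hxy)) +
                (algebraMap ℚ_[3] (CyclotomicField 3 ℚ_[3]) (ab W η α).1 +
                    algebraMap ℚ_[3] (CyclotomicField 3 ℚ_[3]) (ab W η α).2 * χ 2) *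
                  algebraMap ℚ_[3] (CyclotomicField 3 ℚ_[3])
                    (padicEval (W.baseChange ℚ_[3]).formalLog (-(x : ℚ_[3]) / (y : ℚ_[3]))) ^ 2)
    (fun W _ _ η α Dh => by simp only [_root_.map_zero, sub_zero])
    (fun W => W.psUntwistedTrace) h2.1 h1 ?_ ?_
  · exact H
  · -- N-GZ₃′ from S4 at THE matrix and the chosen numbers
    intro W _ _ hCM hO6 hsurj hev hsq hr η α 𝓛 ϖ hη hroot hμ hϖ Dh hDh P hP q hL
    obtain ⟨M, hM, hb0, hdict⟩ := hrow W hO6 hev hsq η α hroot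
    exact h4 ψ ι hψ2 hι W hCM hO6 hsurj hev hsq hr η α 𝓛 ϖ hη hroot hμ hϖ M hM
      (ab W η α).1 (ab W η α).2 hb0 (hdict M hM) Dh hDh P hP q hL
  · -- pBSD₃′ from S5
    intro W _ _ hCM hO6 hsurj hev hsq hr η α 𝓛 ϖ hη hroot hμ hϖ Dh hDh P hP
    obtain ⟨M, hM, hb0, hdict⟩ := hrow W hO6 hev hsq η α hroot
    exact h5 ψ ι hψ2 hι W hCM hO6 hsurj hev hsq hr η α 𝓛 ϖ hη hroot hμ hϖ M hM
      (ab W η α).1 (ab W η α).2 hb0 (hdict M hM) Dh hDh P hP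


/-- **The glue item stmt-BirchSwinnertonDyer-27617 `PSLowerHalfOfDFrobWanChildren` BY NAME**:
`C4 → C5≥ → C1 → C2 → PSRankOneLowerHalfAtThree`. -/
theorem psLowerHalfOfDFrobWanChildren_proof : PSLowerHalfOfDFrobWanChildren :=
  fun h4 h5 h1 h2 => psRankOneLowerHalfAtThree_of_dfrobWanChildren h4 h5 h1 h2

end Summit.BirchSwinnertonDyer.BirchSwinnertonDyer.Theorems.CyclotomicUntwistKSepWanGlue
end
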